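import Summits.CriticalPhenomena.CardyFormulaZ2.Theorems.CardyIKTransportIKLinearTransportLine

/-!
# Stub `stub_ConditionalRSW` (crux stmt-CriticalPhenomena-5076, line `pinned-diagram-exchange`):
# finite energy of the column-mixed IK gauge, II — single-cell flips

Helpers toward the registered stub `stub_ConditionalRSW`. From three ABSTRACT families of flips of the
gauge bit space `Ω` — row signs `R T`, column signs `C T` (`T ⊆ ℤ`, factor `1`) and single plaquettes
`F g` (factor `K`) — each given with its specification (measurable, `μIK ∘ Φ⁻¹ ≤ factor • μIK`, diagonal
coins fixed, toggles the colour of `v` iff: `v 0 ∈ T` / `v 1 ∈ T` / `g` lies in the anchoring rectangle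
`[min 0 v₀, max 0 v₀) × [min 0 v₁, max 0 v₁)` of `v`; these are the exports of the companion file
`…StubConditionalRSWFlips` for the explicit flips), this file builds for EVERY cell `c` a flip with
factor `K⁴` toggling the colour of `c` AND OF NO OTHER CELL, simultaneously for every column pattern `S`
(`exists_cellFlip`). Recipe (`crsw_fourFace_toggle_iff`, pure arithmetic of the anchoring rectangles): the
four plaquettes touching `c` toggle exactly `c` when `c 0 ≠ 0 ≠ c 1`; on the axes one adds the sign bit
of the column `c 0` (if `c 1 = 0`) or of the row `c 1` (if `c 0 = 0`); at the origin one adds the sign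
bit of column `0` and the sign bits of ALL rows `y ≠ 0` (infinitely many fair bits: no finite
modification of the gauge toggles the origin alone, but this infinite one is measure-preserving).
Specifications compose (`crsw_flipSpec_comp`: factors multiply, toggle predicates add mod 2).
-/

noncomputable section

namespace Summit.CriticalPhenomena.CardyFormulaZ2.Theorems.IKLinearTransport.PinnedDiagramExchange

open scoped BigOperators Classical MeasureTheory ProbabilityTheory ENNReal
open Set Function MeasureTheory
open Literature.Probability.Percolation Literature.Probability.LatticeModels

/-! ## §1 Flip specifications compose -/

/-- COMPOSITION of flip specifications: factors multiply, toggle predicates add mod 2. [folklore] -/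
theorem crsw_flipSpec_comp {Φ Ψ : Ω → Ω} {K K' : ℝ≥0∞} {P P' : Site 2 → Prop}
    (hΦ : Measurable Φ ∧ μIK.map Φ ≤ K • μIK ∧ (∀ ω, (Φ ω).2.2.2.2 = ω.2.2.2.2) ∧
      ∀ (S : Set ℤ) (ω : Ω) (v : Site 2), v ∈ blackSet S (Φ ω) ↔ Xor (v ∈ blackSet S ω) (P v))
    (hΨ : Measurable Ψ ∧ μIK.map Ψ ≤ K' • μIK ∧ (∀ ω, (Ψ ω).2.2.2.2 = ω.2.2.2.2) ∧
      ∀ (S : Set ℤ) (ω : Ω) (v : Site 2), v ∈ blackSet S (Ψ ω) ↔ Xor (v ∈ blackSet S ω) (P' v)) :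
    Measurable (Φ ∘ Ψ) ∧ μIK.map (Φ ∘ Ψ) ≤ (K * K') • μIK ∧ (∀ ω, ((Φ ∘ Ψ) ω).2.2.2.2 = ω.2.2.2.2) ∧
      ∀ (S : Set ℤ) (ω : Ω) (v : Site 2),
        v ∈ blackSet S ((Φ ∘ Ψ) ω) ↔ Xor (v ∈ blackSet S ω) (Xor (P' v) (P v)) := by
  obtain ⟨hΦm, hΦb, hΦc, hΦt⟩ := hΦ
  obtain ⟨hΨm, hΨb, hΨc, hΨt⟩ := hΨ
  refine ⟨hΦm.comp hΨm, ?_, fun ω => by rw [Function.comp_apply, hΦc, hΨc], fun S ω v => ?_⟩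
  · rw [← Measure.map_map hΦm hΨm]
    calc (μIK.map Ψ).map Φ ≤ (K' • μIK).map Φ := Measure.map_mono hΨb hΦm
      _ = K' • μIK.map Φ := Measure.map_smul _ _ _
      _ ≤ K' • (K • μIK) := by
          refine Measure.le_iff'.2 fun s => ?_
          simp only [Measure.smul_apply, smul_eq_mul]
          exact mul_le_mul' le_rfl (hΦb s)
      _ = (K * K') • μIK := by rw [smul_smul, mul_comm]
  · rw [Function.comp_apply, hΦt, hΨt]
    grind

/-- Rewriting the toggle predicate and the factor of a flip specification. [folklore] -/
theorem crsw_flipSpec_congr {Φ : Ω → Ω} {K K' : ℝ≥0∞} {P P' : Site 2 → Prop}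
    (hΦ : Measurable Φ ∧ μIK.map Φ ≤ K • μIK ∧ (∀ ω, (Φ ω).2.2.2.2 = ω.2.2.2.2) ∧
      ∀ (S : Set ℤ) (ω : Ω) (v : Site 2), v ∈ blackSet S (Φ ω) ↔ Xor (v ∈ blackSet S ω) (P v))
    (hK : K = K') (hP : ∀ v, P v ↔ P' v) :
    Measurable Φ ∧ μIK.map Φ ≤ K' • μIK ∧ (∀ ω, (Φ ω).2.2.2.2 = ω.2.2.2.2) ∧
      ∀ (S : Set ℤ) (ω : Ω) (v : Site 2), v ∈ blackSet S (Φ ω) ↔ Xor (v ∈ blackSet S ω) (P' v) := by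
  subst hK
  exact ⟨hΦ.1, hΦ.2.1, hΦ.2.2.1, fun S ω v => by rw [hΦ.2.2.2, hP]⟩

/-! ## §2 Arithmetic of the anchoring rectangles -/

/-- Two horizontally adjacent faces `a-1, a` meet the anchoring interval `[min 0 x, max 0 x)` an odd
number of times iff `x ≠ 0` and `a ∈ {0, x}`. [folklore] -/
theorem crsw_xor_interval_iff (a x : ℤ) :
    Xor (min 0 x ≤ a - 1 ∧ a - 1 < max 0 x) (min 0 x ≤ a ∧ a < max 0 x) ↔ (x ≠ 0 ∧ (a = 0 ∨ a = x)) := by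
  rcases le_total 0 x with hx | hx
  · rw [min_eq_left hx, max_eq_right hx, xor_def]; omega
  · rw [min_eq_right hx, max_eq_left hx, xor_def]; omega

/-- Exclusive-or of the four corner products. [folklore] -/
theorem crsw_xor_four_and (a₁ a₂ b₁ b₂ : Prop) :
    Xor (Xor (Xor (a₂ ∧ b₂) (a₁ ∧ b₂)) (a₂ ∧ b₁)) (a₁ ∧ b₁) ↔ (Xor a₁ a₂ ∧ Xor b₁ b₂) := by
  grind

/-- Coordinates of the shifted faces. [folklore] -/
theorem crsw_face_coords (c : Site 2) :
    ((c + ![-1, -1] : Site 2) 0) = c 0 - 1 ∧ ((c + ![-1, -1] : Site 2) 1) = c 1 - 1 ∧ ((c + ![0, -1] : Site 2) 0) = c 0 ∧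
      ((c + ![0, -1] : Site 2) 1) = c 1 - 1 ∧ ((c + ![-1, 0] : Site 2) 0) = c 0 - 1 ∧ ((c + ![-1, 0] : Site 2) 1) = c 1 := by
  simp only [Pi.add_apply, Matrix.cons_val_zero, Matrix.cons_val_one, Matrix.cons_val_fin_one]
  omega

/-- THE FOUR FACES AROUND `c` toggle, in total, the cells `v` with `v 0 ≠ 0`, `c 0 ∈ {0, v 0}`,
`v 1 ≠ 0`, `c 1 ∈ {0, v 1}`. [folklore] -/
theorem crsw_fourFace_toggle_iff (c v : Site 2) :
    Xor (Xor (Xor ((min 0 (v 0) ≤ c 0 ∧ c 0 < max 0 (v 0)) ∧ (min 0 (v 1) ≤ c 1 ∧ c 1 < max 0 (v 1)))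
      ((min 0 (v 0) ≤ ((c + ![-1, 0] : Site 2) 0) ∧ ((c + ![-1, 0] : Site 2) 0) < max 0 (v 0)) ∧
        (min 0 (v 1) ≤ ((c + ![-1, 0] : Site 2) 1) ∧ ((c + ![-1, 0] : Site 2) 1) < max 0 (v 1))))
      ((min 0 (v 0) ≤ ((c + ![0, -1] : Site 2) 0) ∧ ((c + ![0, -1] : Site 2) 0) < max 0 (v 0)) ∧
        (min 0 (v 1) ≤ ((c + ![0, -1] : Site 2) 1) ∧ ((c + ![0, -1] : Site 2) 1) < max 0 (v 1))))
      ((min 0 (v 0) ≤ ((c + ![-1, -1] : Site 2) 0) ∧ ((c + ![-1, -1] : Site 2) 0) < max 0 (v 0)) ∧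
        (min 0 (v 1) ≤ ((c + ![-1, -1] : Site 2) 1) ∧ ((c + ![-1, -1] : Site 2) 1) < max 0 (v 1))) ↔
    (v 0 ≠ 0 ∧ (c 0 = 0 ∨ c 0 = v 0)) ∧ (v 1 ≠ 0 ∧ (c 1 = 0 ∨ c 1 = v 1)) := by
  obtain ⟨h1, h2, h3, h4, h5, h6⟩ := crsw_face_coords c
  rw [h1, h2, h3, h4, h5, h6, crsw_xor_four_and, crsw_xor_interval_iff, crsw_xor_interval_iff]

/-! ## §3 Single-cell flips from the three generator families

The generators are ABSTRACT here: families `R, C : Set ℤ → Ω → Ω` (row / column signs) and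
`F : Site 2 → Ω → Ω` (plaquettes) with their specifications as hypotheses `hR, hC, hF` (discharged by
the explicit flips of the companion file `…StubConditionalRSWFlips`). -/

section Cells

variable {R C : Set ℤ → Ω → Ω} {F : Site 2 → Ω → Ω} {K : ℝ≥0∞}

/-- THE FOUR PLAQUETTES AROUND `c`: factor `K⁴`, toggle set computed by `crsw_fourFace_toggle_iff`. [folklore] -/
theorem crsw_fourFace_spec
    (hF : ∀ g : Site 2, Measurable (F g) ∧ μIK.map (F g) ≤ K • μIK ∧
      (∀ ω, (F g ω).2.2.2.2 = ω.2.2.2.2) ∧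
      ∀ (S : Set ℤ) (ω : Ω) (v : Site 2), v ∈ blackSet S (F g ω) ↔ Xor (v ∈ blackSet S ω)
        ((min 0 (v 0) ≤ g 0 ∧ g 0 < max 0 (v 0)) ∧ (min 0 (v 1) ≤ g 1 ∧ g 1 < max 0 (v 1)))) (c : Site 2) :
    Measurable (F (c + ![-1, -1]) ∘ F (c + ![0, -1]) ∘ F (c + ![-1, 0]) ∘ F c) ∧ μIK.map (F (c + ![-1, -1]) ∘ F (c + ![0, -1]) ∘ F (c + ![-1, 0]) ∘ F c) ≤ K ^ 4 • μIK ∧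
      (∀ ω, ((F (c + ![-1, -1]) ∘ F (c + ![0, -1]) ∘ F (c + ![-1, 0]) ∘ F c) ω).2.2.2.2 = ω.2.2.2.2) ∧
      ∀ (S : Set ℤ) (ω : Ω) (v : Site 2), v ∈ blackSet S ((F (c + ![-1, -1]) ∘ F (c + ![0, -1]) ∘ F (c + ![-1, 0]) ∘ F c) ω) ↔ Xor (v ∈ blackSet S ω) ((v 0 ≠ 0 ∧ (c 0 = 0 ∨ c 0 = v 0)) ∧ (v 1 ≠ 0 ∧ (c 1 = 0 ∨ c 1 = v 1))) := by
  have h := crsw_flipSpec_comp (hF (c + ![-1, -1]))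
    (crsw_flipSpec_comp (hF (c + ![0, -1])) (crsw_flipSpec_comp (hF (c + ![-1, 0])) (hF c)))
  exact crsw_flipSpec_congr h (by ring) fun v => crsw_fourFace_toggle_iff c v

/-- GENERIC CELL (`c 0 ≠ 0`, `c 1 ≠ 0`): the four plaquettes around `c` toggle exactly `c`. [folklore] -/
theorem crsw_cellFlip_generic
    (hF : ∀ g : Site 2, Measurable (F g) ∧ μIK.map (F g) ≤ K • μIK ∧
      (∀ ω, (F g ω).2.2.2.2 = ω.2.2.2.2) ∧
      ∀ (S : Set ℤ) (ω : Ω) (v : Site 2), v ∈ blackSet S (F g ω) ↔ Xor (v ∈ blackSet S ω)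
        ((min 0 (v 0) ≤ g 0 ∧ g 0 < max 0 (v 0)) ∧ (min 0 (v 1) ≤ g 1 ∧ g 1 < max 0 (v 1)))) {c : Site 2} (h0 : c 0 ≠ 0) (h1 : c 1 ≠ 0) :
    Measurable (F (c + ![-1, -1]) ∘ F (c + ![0, -1]) ∘ F (c + ![-1, 0]) ∘ F c) ∧ μIK.map (F (c + ![-1, -1]) ∘ F (c + ![0, -1]) ∘ F (c + ![-1, 0]) ∘ F c) ≤ K ^ 4 • μIK ∧
      (∀ ω, ((F (c + ![-1, -1]) ∘ F (c + ![0, -1]) ∘ F (c + ![-1, 0]) ∘ F c) ω).2.2.2.2 = ω.2.2.2.2) ∧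
      ∀ (S : Set ℤ) (ω : Ω) (v : Site 2), v ∈ blackSet S ((F (c + ![-1, -1]) ∘ F (c + ![0, -1]) ∘ F (c + ![-1, 0]) ∘ F c) ω) ↔ Xor (v ∈ blackSet S ω) (v = c) :=
  crsw_flipSpec_congr (crsw_fourFace_spec hF c) rfl fun v => by rw [funext_iff, Fin.forall_fin_two]; omega

/-- ROW-AXIS CELL (`c 1 = 0`, `c 0 ≠ 0`): the sign bit of column `c 0` and the four plaquettes. [folklore] -/
theorem crsw_cellFlip_rowAxis
    (hR : ∀ T : Set ℤ, Measurable (R T) ∧ μIK.map (R T) ≤ (1 : ℝ≥0∞) • μIK ∧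
      (∀ ω, (R T ω).2.2.2.2 = ω.2.2.2.2) ∧
      ∀ (S : Set ℤ) (ω : Ω) (v : Site 2), v ∈ blackSet S (R T ω) ↔ Xor (v ∈ blackSet S ω) (v 0 ∈ T))
    (hF : ∀ g : Site 2, Measurable (F g) ∧ μIK.map (F g) ≤ K • μIK ∧
      (∀ ω, (F g ω).2.2.2.2 = ω.2.2.2.2) ∧
      ∀ (S : Set ℤ) (ω : Ω) (v : Site 2), v ∈ blackSet S (F g ω) ↔ Xor (v ∈ blackSet S ω)
        ((min 0 (v 0) ≤ g 0 ∧ g 0 < max 0 (v 0)) ∧ (min 0 (v 1) ≤ g 1 ∧ g 1 < max 0 (v 1)))) {c : Site 2} (h0 : c 0 ≠ 0) (h1 : c 1 = 0) :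
    Measurable (R {c 0} ∘ F (c + ![-1, -1]) ∘ F (c + ![0, -1]) ∘ F (c + ![-1, 0]) ∘ F c) ∧ μIK.map (R {c 0} ∘ F (c + ![-1, -1]) ∘ F (c + ![0, -1]) ∘ F (c + ![-1, 0]) ∘ F c) ≤ K ^ 4 • μIK ∧
      (∀ ω, ((R {c 0} ∘ F (c + ![-1, -1]) ∘ F (c + ![0, -1]) ∘ F (c + ![-1, 0]) ∘ F c) ω).2.2.2.2 = ω.2.2.2.2) ∧
      ∀ (S : Set ℤ) (ω : Ω) (v : Site 2), v ∈ blackSet S ((R {c 0} ∘ F (c + ![-1, -1]) ∘ F (c + ![0, -1]) ∘ F (c + ![-1, 0]) ∘ F c) ω) ↔ Xor (v ∈ blackSet S ω) (v = c) :=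
  crsw_flipSpec_congr (crsw_flipSpec_comp (hR {c 0}) (crsw_fourFace_spec hF c)) (one_mul _) fun v => by
    rw [funext_iff, Fin.forall_fin_two, Set.mem_singleton_iff, xor_def]; omega

/-- COLUMN-AXIS CELL (`c 0 = 0`, `c 1 ≠ 0`): the sign bit of row `c 1` and the four plaquettes. [folklore] -/
theorem crsw_cellFlip_colAxis
    (hC : ∀ T : Set ℤ, Measurable (C T) ∧ μIK.map (C T) ≤ (1 : ℝ≥0∞) • μIK ∧
      (∀ ω, (C T ω).2.2.2.2 = ω.2.2.2.2) ∧
      ∀ (S : Set ℤ) (ω : Ω) (v : Site 2), v ∈ blackSet S (C T ω) ↔ Xor (v ∈ blackSet S ω) (v 1 ∈ T))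
    (hF : ∀ g : Site 2, Measurable (F g) ∧ μIK.map (F g) ≤ K • μIK ∧
      (∀ ω, (F g ω).2.2.2.2 = ω.2.2.2.2) ∧
      ∀ (S : Set ℤ) (ω : Ω) (v : Site 2), v ∈ blackSet S (F g ω) ↔ Xor (v ∈ blackSet S ω)
        ((min 0 (v 0) ≤ g 0 ∧ g 0 < max 0 (v 0)) ∧ (min 0 (v 1) ≤ g 1 ∧ g 1 < max 0 (v 1)))) {c : Site 2} (h0 : c 0 = 0) (h1 : c 1 ≠ 0) :
    Measurable (C {c 1} ∘ F (c + ![-1, -1]) ∘ F (c + ![0, -1]) ∘ F (c + ![-1, 0]) ∘ F c) ∧ μIK.map (C {c 1} ∘ F (c + ![-1, -1]) ∘ F (c + ![0, -1]) ∘ F (c + ![-1, 0]) ∘ F c) ≤ K ^ 4 • μIK ∧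
      (∀ ω, ((C {c 1} ∘ F (c + ![-1, -1]) ∘ F (c + ![0, -1]) ∘ F (c + ![-1, 0]) ∘ F c) ω).2.2.2.2 = ω.2.2.2.2) ∧
      ∀ (S : Set ℤ) (ω : Ω) (v : Site 2), v ∈ blackSet S ((C {c 1} ∘ F (c + ![-1, -1]) ∘ F (c + ![0, -1]) ∘ F (c + ![-1, 0]) ∘ F c) ω) ↔ Xor (v ∈ blackSet S ω) (v = c) :=
  crsw_flipSpec_congr (crsw_flipSpec_comp (hC {c 1}) (crsw_fourFace_spec hF c)) (one_mul _) fun v => by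
    rw [funext_iff, Fin.forall_fin_two, Set.mem_singleton_iff, xor_def]; omega

/-- THE ORIGIN: the sign bit of column `0`, ALL the sign bits of the rows `y ≠ 0` (infinitely many fair
bits — no finite modification toggles the origin alone), and the four plaquettes. [folklore] -/
theorem crsw_cellFlip_origin
    (hR : ∀ T : Set ℤ, Measurable (R T) ∧ μIK.map (R T) ≤ (1 : ℝ≥0∞) • μIK ∧
      (∀ ω, (R T ω).2.2.2.2 = ω.2.2.2.2) ∧
      ∀ (S : Set ℤ) (ω : Ω) (v : Site 2), v ∈ blackSet S (R T ω) ↔ Xor (v ∈ blackSet S ω) (v 0 ∈ T))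
    (hC : ∀ T : Set ℤ, Measurable (C T) ∧ μIK.map (C T) ≤ (1 : ℝ≥0∞) • μIK ∧
      (∀ ω, (C T ω).2.2.2.2 = ω.2.2.2.2) ∧
      ∀ (S : Set ℤ) (ω : Ω) (v : Site 2), v ∈ blackSet S (C T ω) ↔ Xor (v ∈ blackSet S ω) (v 1 ∈ T))
    (hF : ∀ g : Site 2, Measurable (F g) ∧ μIK.map (F g) ≤ K • μIK ∧
      (∀ ω, (F g ω).2.2.2.2 = ω.2.2.2.2) ∧
      ∀ (S : Set ℤ) (ω : Ω) (v : Site 2), v ∈ blackSet S (F g ω) ↔ Xor (v ∈ blackSet S ω)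
        ((min 0 (v 0) ≤ g 0 ∧ g 0 < max 0 (v 0)) ∧ (min 0 (v 1) ≤ g 1 ∧ g 1 < max 0 (v 1)))) {c : Site 2} (h0 : c 0 = 0) (h1 : c 1 = 0) :
    Measurable (R {0} ∘ C {y : ℤ | y ≠ 0} ∘ F (c + ![-1, -1]) ∘ F (c + ![0, -1]) ∘ F (c + ![-1, 0]) ∘ F c) ∧ μIK.map (R {0} ∘ C {y : ℤ | y ≠ 0} ∘ F (c + ![-1, -1]) ∘ F (c + ![0, -1]) ∘ F (c + ![-1, 0]) ∘ F c) ≤ K ^ 4 • μIK ∧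
      (∀ ω, ((R {0} ∘ C {y : ℤ | y ≠ 0} ∘ F (c + ![-1, -1]) ∘ F (c + ![0, -1]) ∘ F (c + ![-1, 0]) ∘ F c) ω).2.2.2.2 = ω.2.2.2.2) ∧
      ∀ (S : Set ℤ) (ω : Ω) (v : Site 2), v ∈ blackSet S ((R {0} ∘ C {y : ℤ | y ≠ 0} ∘ F (c + ![-1, -1]) ∘ F (c + ![0, -1]) ∘ F (c + ![-1, 0]) ∘ F c) ω) ↔ Xor (v ∈ blackSet S ω) (v = c) :=
  crsw_flipSpec_congr (crsw_flipSpec_comp (hR {0}) (crsw_flipSpec_comp (hC {y : ℤ | y ≠ 0}) (crsw_fourFace_spec hF c)))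
    (by rw [one_mul, one_mul]) fun v => by
    rw [funext_iff, Fin.forall_fin_two, Set.mem_singleton_iff, Set.mem_setOf_eq, xor_def, xor_def]; omega

end Cells

/-- SINGLE-CELL FLIPS (registered sub-goal `exists_cellFlip`). For every cell `c` there is a measurable
flip of the gauge bits changing `μIK` by at most the factor `K⁴`, fixing the diagonal coins, and toggling
the colour of `c` and of no other cell, simultaneously for every column pattern `S` — given the three
generator families with their specifications. [folklore] -/
theorem exists_cellFlip : ∀ {R C : Set ℤ → Ω → Ω} {F : Site 2 → Ω → Ω} {K : ENNReal},
    (∀ T : Set ℤ, Measurable (R T) ∧ μIK.map (R T) ≤ (1 : ENNReal) • μIK ∧ (∀ ω, (R T ω).2.2.2.2 = ω.2.2.2.2) ∧ ∀ (S : Set ℤ) (ω : Ω) (v : Site 2), v ∈ blackSet S (R T ω) ↔ Xor (v ∈ blackSet S ω) (v 0 ∈ T)) →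
    (∀ T : Set ℤ, Measurable (C T) ∧ μIK.map (C T) ≤ (1 : ENNReal) • μIK ∧ (∀ ω, (C T ω).2.2.2.2 = ω.2.2.2.2) ∧ ∀ (S : Set ℤ) (ω : Ω) (v : Site 2), v ∈ blackSet S (C T ω) ↔ Xor (v ∈ blackSet S ω) (v 1 ∈ T)) →
    (∀ g : Site 2, Measurable (F g) ∧ μIK.map (F g) ≤ K • μIK ∧ (∀ ω, (F g ω).2.2.2.2 = ω.2.2.2.2) ∧ ∀ (S : Set ℤ) (ω : Ω) (v : Site 2), v ∈ blackSet S (F g ω) ↔ Xor (v ∈ blackSet S ω) ((min 0 (v 0) ≤ g 0 ∧ g 0 < max 0 (v 0)) ∧ (min 0 (v 1) ≤ g 1 ∧ g 1 < max 0 (v 1)))) →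
    ∀ c : Site 2, ∃ Φ : Ω → Ω, Measurable Φ ∧ μIK.map Φ ≤ (K ^ 4) • μIK ∧ (∀ ω, (Φ ω).2.2.2.2 = ω.2.2.2.2) ∧
      ∀ (S : Set ℤ) (ω : Ω) (v : Site 2), v ∈ blackSet S (Φ ω) ↔ Xor (v ∈ blackSet S ω) (v = c) := by
  intro R C F K hR hC hF c
  by_cases h0 : c 0 = 0 <;> by_cases h1 : c 1 = 0
  · exact ⟨_, crsw_cellFlip_origin hR hC hF h0 h1⟩
  · exact ⟨_, crsw_cellFlip_colAxis hC hF h0 h1⟩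
  · exact ⟨_, crsw_cellFlip_rowAxis hR hF h0 h1⟩
  · exact ⟨_, crsw_cellFlip_generic hF h0 h1⟩


end Summit.CriticalPhenomena.CardyFormulaZ2.Theorems.IKLinearTransport.PinnedDiagramExchange
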